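import Summits.ResolutionOfSingularities.ResolutionOfSingularities.Theorems.EquisingularLiftEquisingularLiftNatSubmaxLineAlgebra
import Summits.ResolutionOfSingularities.ResolutionOfSingularities.Theorems.EquisingularLiftEquisingularLiftNatDoubleLineBlowupCharts
import Summits.ResolutionOfSingularities.ResolutionOfSingularities.Theorems.EquisingularLiftEquisingularLiftNatNoseTowerBTriplePrimeDoubleLine
import Summits.ResolutionOfSingularities.ResolutionOfSingularities.Theorems.EquisingularLiftEquisingularLiftNatSpecimenWhitneyCubicForms
import Mathlib.Algebra.MvPolynomial.NoZeroDivisors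
import HarnessLib

/-!
# [OURS · EL♮(3)] SURFACES OF DEGREE `d + 2` IN `ℙ³` WITH A LINE OF MULTIPLICITY `d + 1` — ONE blow-up along the line resolves:
# `ReachNoseTowerBTriplePrime` and `ELNatAt` for the whole family `F = x₀·A(x₂,x₃) + x₁·B(x₂,x₃) + C(x₂,x₃)`, every characteristic
# (crux `Theses.EquisingularLift.EquisingularLiftNatThree`, stmt-ResolutionOfSingularities-20148; parent EL♮ stmt-…-20038)

[OURS · leafhand-res-equisingularlift-7 g0, 2026-08-31; cell `pub/decomp-res`] AI-produced, weaker than expert review; NOT a statement of any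
manuscript; nothing here proves resolution of singularities in positive characteristic.  DEF-FREE helper (`--supports stmt-…-20148`); no `sorry`;
standard axioms; ZERO named hypotheses.

THE FAMILY.  `K` algebraically closed, `A, B ∈ K[s, t]` binary forms of degree `d + 1`, `C ∈ K[s, t]` a binary form of degree `d + 2`, and

  `F = x₀ · A(x₂, x₃) + x₁ · B(x₂, x₃) + C(x₂, x₃) ∈ K[x₀, x₁, x₂, x₃]`

— equivalently: `F` is a form of degree `d + 2` lying in `(x₂, x₃)^{d+1}`, i.e. the surface `H = V₊(F) ⊂ ℙ³_K` has multiplicity `≥ d + 1` along the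
line `Σ = V(x₂, x₃)`.  Hypotheses: `F` prime, `(A, B) ≠ (0, 0)`, and `A, B, C` have no common zero on `ℙ¹` (both hold automatically for a prime `F` of
degree `≥ 2` over `K = K̄`; not formalised here — they are one-line checks in every instance).  CONCLUSION: every blow-up of `H` along
`𝓘⟨Σ⟩ · 𝒪_H` is regular, hence `ReachNoseTowerBTriplePrime K 3 H ι` and `ELNatAt p K 3 H ι` through the generic double-line package
(`DoubleLine.isRegular_of_isBlowup_comap_vanishingIdeal`, `DoubleLine.elNatAt_of_isRegular_blowups`, p645742 / p645692).

WHY ONE BLOW-UP SUFFICES (uniformly in `A, B, C`): on `D₊(x₀)`, `f₀ = A(y₁,y₂) + y₀ B(y₁,y₂) + C(y₁,y₂)`; Hu's substitution `y₂ ↦ y₁y₂` gives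
`f₀ ↦ y₁^{d+1} · (y₀·B(1,y₂) + y₁·C(1,y₂) + A(1,y₂))`, a strict transform LINEAR in `y₀, y₁` with `∂_{y₀} = B(1,y₂)`, `∂_{y₁} = C(1,y₂)`: a singular point
would be a common zero `[1 : y₂]` of `A, B, C` (Nullstellensatz); likewise for the other three strict-transform charts and the charts `D₊(x₂)`, `D₊(x₃)`.
INSTANCES (all `p`, no classification): every integral cubic surface singular along the line `V(x₂,x₃)` (the four classical ruled / conical types,
previously certified one form at a time, AND every cone over a singular integral plane cubic); integral quartics with a triple line; … .  With the
`PGL₄`-transport `elNatAt_of_elNatAt_linSubst` (p820173) the line may be any line.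

The algebra (engine `isRegularRing_quotient_lin`, injectivity of dehomogenisation, Hu's substitution on binary forms) is `…NatSubmaxLineAlgebra`.

* `isHomogeneous_F`, `F_mem_span`, `X_two_not_mem_span`, `radical_span_dehomogenize`; `dehomogenize_eq₀/₁/₂/₃` (chart equations),
  `subst₁_f₀/subst₂_f₀/subst₁_f₁/subst₂_f₁` (strict transforms); `isRegularRing_quotient_f₂/f₃/strict₁/strict₂`, `isRegularRing_chartRing_of_two_le`;
* ★ `isRegular_blowups` — every blow-up of `H` along `𝓘⟨Σ⟩·𝒪_H` is regular; ★ `blowupModel_submaxLine` (the blow-up-model currency of crux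
  `EquisingularLift`, stmt-…-15660); ★ `reachNoseTowerBTriplePrime_submaxLine`; ★★ `elNatAt_submaxLine`.

References: The Stacks Project 07PF, 0804; Görtz–Wedhorn Prop. 13.96; Hu 2025 §5 Prop. 5.3 — through the cited tree files.
-/

set_option linter.dupNamespace false -- mandated namespace `Summit.<Summit>.<Problem>` of this single-conjunct summit

noncomputable section

open CategoryTheory CategoryTheory.Limits AlgebraicGeometry TopologicalSpace
open MvPolynomial HomogeneousLocalization
open Literature.AlgebraicGeometry.Resolution
open Literature.AlgebraicGeometry.Motives Literature.AlgebraicGeometry.Motives.SmoothHypersurface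
open Literature.AlgebraicGeometry.Motives.ProjectiveSpace
open AlgebraicGeometry.Scheme.IdealSheafData

namespace Summit.ResolutionOfSingularities.ResolutionOfSingularities.Cruxes.EquisingularLiftNat.Sections

namespace SubmaxLine

variable (K : Type) [Field K]

/-! ## The family `F = x₀·A(x₂,x₃) + x₁·B(x₂,x₃) + C(x₂,x₃)` and its chart equations -/

section Family

variable {d : ℕ} (A B C : MvPolynomial (Fin 2) K) (hA : A.IsHomogeneous (d + 1)) (hB : B.IsHomogeneous (d + 1))
  (hC : C.IsHomogeneous (d + 2)) (F : MvPolynomial (Fin 4) K)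
  (hF : F = X 0 * rename (![2, 3] : Fin 2 → Fin 4) A + X 1 * rename (![2, 3] : Fin 2 → Fin 4) B + rename (![2, 3] : Fin 2 → Fin 4) C)

include hA hB hC hF in
/-- `F` is homogeneous of degree `d + 2`. [folklore] -/
theorem isHomogeneous_F : F.IsHomogeneous (d + 2) := by
  rw [hF]
  have h0 : (X 0 * rename (![2, 3] : Fin 2 → Fin 4) A : MvPolynomial (Fin 4) K).IsHomogeneous (d + 2) := by
    have h := (isHomogeneous_X K (0 : Fin 4)).mul (hA.rename_isHomogeneous (f := (![2, 3] : Fin 2 → Fin 4)))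
    rwa [show 1 + (d + 1) = d + 2 by omega] at h
  have h1 : (X 1 * rename (![2, 3] : Fin 2 → Fin 4) B : MvPolynomial (Fin 4) K).IsHomogeneous (d + 2) := by
    have h := (isHomogeneous_X K (1 : Fin 4)).mul (hB.rename_isHomogeneous (f := (![2, 3] : Fin 2 → Fin 4)))
    rwa [show 1 + (d + 1) = d + 2 by omega] at h
  exact (h0.add h1).add hC.rename_isHomogeneous

/-- A binary form of positive degree, placed in the variables `x₂, x₃`, lies in `(x₂, x₃)`. [folklore] -/
theorem rename_mem_span (G : MvPolynomial (Fin 2) K) {m : ℕ} (hG : G.IsHomogeneous m) (hm : 0 < m) :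
    rename (![2, 3] : Fin 2 → Fin 4) G ∈ Ideal.span {(X 2 : MvPolynomial (Fin 4) K), X 3} := by
  classical
  have hG0 : G.coeff 0 = 0 := hG.coeff_eq_zero (by
    rw [map_zero]
    omega)
  have hmem : G ∈ Ideal.span (Set.range (X : Fin 2 → MvPolynomial (Fin 2) K)) := by
    rw [← Set.image_univ, MvPolynomial.mem_ideal_span_X_image]
    intro s hs
    have hs0 : s ≠ 0 := by
      rintro rfl
      exact (mem_support_iff.mp hs) hG0
    obtain ⟨j, hj⟩ := Finsupp.ne_iff.mp hs0
    exact ⟨j, Set.mem_univ _, hj⟩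
  have h := Ideal.mem_map_of_mem (rename (![2, 3] : Fin 2 → Fin 4) : MvPolynomial (Fin 2) K →ₐ[K] MvPolynomial (Fin 4) K) hmem
  rw [Ideal.map_span, ← Set.range_comp] at h
  refine Ideal.span_mono ?_ h
  rintro _ ⟨j, rfl⟩
  fin_cases j <;> simp [rename_X]

include hA hB hC hF in
/-- **`F ∈ (x₂, x₃)`** — the line `Σ = V(x₂, x₃)` lies on `H`. [folklore] -/
theorem F_mem_span : F ∈ Ideal.span {(X 2 : MvPolynomial (Fin 4) K), X 3} := by
  rw [hF]
  refine Ideal.add_mem _ (Ideal.add_mem _ (Ideal.mul_mem_left _ _ (rename_mem_span K A hA (by omega)))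
    (Ideal.mul_mem_left _ _ (rename_mem_span K B hB (by omega)))) (rename_mem_span K C hC (by omega))

include hA hB hC hF in
/-- **`x₂ ∉ (F)`** (degrees: `deg F = d + 2 ≥ 2 > 1`). [folklore] -/
theorem X_two_not_mem_span (hF0 : F ≠ 0) : (X 2 : MvPolynomial (Fin 4) K) ∉ Ideal.span {F} := by
  intro h
  obtain ⟨q, hq⟩ := Ideal.mem_span_singleton'.mp h
  have hq0 : q ≠ 0 := by
    rintro rfl
    rw [zero_mul] at hq
    exact X_ne_zero (2 : Fin 4) hq.symm
  have hdeg := congrArg MvPolynomial.totalDegree hq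
  rw [totalDegree_mul_of_isDomain hq0 hF0, (isHomogeneous_F K A B C hA hB hC F hF).totalDegree hF0, totalDegree_X] at hdeg
  omega

/-- **Dehomogenising a form in `x₂, x₃`**: `G(x₂, x₃)(x_c := 1) = G(g)` with `g = (x₂(x_c:=1), x₃(x_c:=1))`. [folklore] -/
theorem dehomogenize_rename (c : Fin 4) (g : Fin 2 → MvPolynomial (Fin 3) K)
    (h2 : dehomogenize K c (X 2 : MvPolynomial (Fin 4) K) = g 0) (h3 : dehomogenize K c (X 3 : MvPolynomial (Fin 4) K) = g 1)
    (G : MvPolynomial (Fin 2) K) :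
    dehomogenize K c (rename (![2, 3] : Fin 2 → Fin 4) G) = aeval g G := by
  have h : (dehomogenize K c).comp (rename (![2, 3] : Fin 2 → Fin 4) : MvPolynomial (Fin 2) K →ₐ[K] MvPolynomial (Fin 4) K) =
      aeval g := by
    apply MvPolynomial.algHom_ext
    intro j
    fin_cases j
    · simpa [rename_X] using h2
    · simpa [rename_X] using h3
  exact DFunLike.congr_fun h G

include hF in
/-- **Chart `D₊(x₀)`** (`y = (x₁, x₂, x₃)`): `F(x₀ := 1) = A(y₁,y₂) + y₀·B(y₁,y₂) + C(y₁,y₂)`. [folklore] -/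
theorem dehomogenize_eq₀ : dehomogenize K 0 F =
    aeval (![X 1, X 2] : Fin 2 → MvPolynomial (Fin 3) K) A + X 0 * aeval (![X 1, X 2] : Fin 2 → MvPolynomial (Fin 3) K) B +
      aeval (![X 1, X 2] : Fin 2 → MvPolynomial (Fin 3) K) C := by
  have h2 := WhitneyCubic.dehomogenize_X_of_eq K 0 2 1 (by decide)
  have h3 := WhitneyCubic.dehomogenize_X_of_eq K 0 3 2 (by decide)
  rw [hF, map_add, map_add, map_mul, map_mul, dehomogenize_X_self, WhitneyCubic.dehomogenize_X_of_eq K 0 1 0 (by decide),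
    dehomogenize_rename K 0 ![X 1, X 2] h2 h3, dehomogenize_rename K 0 ![X 1, X 2] h2 h3,
    dehomogenize_rename K 0 ![X 1, X 2] h2 h3, one_mul]

include hF in
/-- **Chart `D₊(x₁)`** (`y = (x₀, x₂, x₃)`): `F(x₁ := 1) = y₀·A(y₁,y₂) + B(y₁,y₂) + C(y₁,y₂)`. [folklore] -/
theorem dehomogenize_eq₁ : dehomogenize K 1 F =
    X 0 * aeval (![X 1, X 2] : Fin 2 → MvPolynomial (Fin 3) K) A + aeval (![X 1, X 2] : Fin 2 → MvPolynomial (Fin 3) K) B +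
      aeval (![X 1, X 2] : Fin 2 → MvPolynomial (Fin 3) K) C := by
  have h2 := WhitneyCubic.dehomogenize_X_of_eq K 1 2 1 (by decide)
  have h3 := WhitneyCubic.dehomogenize_X_of_eq K 1 3 2 (by decide)
  rw [hF, map_add, map_add, map_mul, map_mul, dehomogenize_X_self, WhitneyCubic.dehomogenize_X_of_eq K 1 0 0 (by decide),
    dehomogenize_rename K 1 ![X 1, X 2] h2 h3, dehomogenize_rename K 1 ![X 1, X 2] h2 h3,
    dehomogenize_rename K 1 ![X 1, X 2] h2 h3, one_mul]

include hF in
/-- **Chart `D₊(x₂)`** (`y = (x₀, x₁, x₃)`, off the line): `F(x₂ := 1) = y₀·A(1,y₂) + y₁·B(1,y₂) + C(1,y₂)`. [folklore] -/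
theorem dehomogenize_eq₂ : dehomogenize K 2 F =
    X 0 * aeval (![1, X 2] : Fin 2 → MvPolynomial (Fin 3) K) A + X 1 * aeval (![1, X 2] : Fin 2 → MvPolynomial (Fin 3) K) B +
      aeval (![1, X 2] : Fin 2 → MvPolynomial (Fin 3) K) C := by
  have h2 : dehomogenize K 2 (X 2 : MvPolynomial (Fin 4) K) = (![1, X 2] : Fin 2 → MvPolynomial (Fin 3) K) 0 := dehomogenize_X_self K 2
  have h3 := WhitneyCubic.dehomogenize_X_of_eq K 2 3 2 (by decide)
  rw [hF, map_add, map_add, map_mul, map_mul, WhitneyCubic.dehomogenize_X_of_eq K 2 0 0 (by decide),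
    WhitneyCubic.dehomogenize_X_of_eq K 2 1 1 (by decide),
    dehomogenize_rename K 2 ![1, X 2] h2 h3, dehomogenize_rename K 2 ![1, X 2] h2 h3, dehomogenize_rename K 2 ![1, X 2] h2 h3]

include hF in
/-- **Chart `D₊(x₃)`** (`y = (x₀, x₁, x₂)`, off the line): `F(x₃ := 1) = y₀·A(y₂,1) + y₁·B(y₂,1) + C(y₂,1)`. [folklore] -/
theorem dehomogenize_eq₃ : dehomogenize K 3 F =
    X 0 * aeval (![X 2, 1] : Fin 2 → MvPolynomial (Fin 3) K) A + X 1 * aeval (![X 2, 1] : Fin 2 → MvPolynomial (Fin 3) K) B +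
      aeval (![X 2, 1] : Fin 2 → MvPolynomial (Fin 3) K) C := by
  have h2 := WhitneyCubic.dehomogenize_X_of_eq K 3 2 2 (by decide)
  have h3 : dehomogenize K 3 (X 3 : MvPolynomial (Fin 4) K) = (![X 2, 1] : Fin 2 → MvPolynomial (Fin 3) K) 1 := dehomogenize_X_self K 3
  rw [hF, map_add, map_add, map_mul, map_mul, WhitneyCubic.dehomogenize_X_of_eq K 3 0 0 (by decide),
    WhitneyCubic.dehomogenize_X_of_eq K 3 1 1 (by decide),
    dehomogenize_rename K 3 ![X 2, 1] h2 h3, dehomogenize_rename K 3 ![X 2, 1] h2 h3, dehomogenize_rename K 3 ![X 2, 1] h2 h3]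

include hA hB hC in
/-- **Strict transform, chart `D₊(x₀)`, `b = y₁`**: `f₀ ↦ y₁^{d+1} · (y₀·B(1,y₂) + y₁·C(1,y₂) + A(1,y₂))`. [cite: Hu2025, §5 Prop. 5.3] -/
theorem subst₁_f₀ : coordBlowupSubst K CuspCone.cenVars 1
    (aeval (![X 1, X 2] : Fin 2 → MvPolynomial (Fin 3) K) A + X 0 * aeval (![X 1, X 2] : Fin 2 → MvPolynomial (Fin 3) K) B +
      aeval (![X 1, X 2] : Fin 2 → MvPolynomial (Fin 3) K) C) =
    X 1 ^ (d + 1) * (X 0 * aeval (![1, X 2] : Fin 2 → MvPolynomial (Fin 3) K) B +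
      X 1 * aeval (![1, X 2] : Fin 2 → MvPolynomial (Fin 3) K) C + aeval (![1, X 2] : Fin 2 → MvPolynomial (Fin 3) K) A) := by
  obtain ⟨h0, -, -⟩ := CuspCone.subst₁_X K
  rw [map_add, map_add, map_mul, h0, subst_aeval K 1 _ _ _ (subst₁_g K) A hA, subst_aeval K 1 _ _ _ (subst₁_g K) B hB,
    subst_aeval K 1 _ _ _ (subst₁_g K) C hC]
  ring

include hA hB hC in
/-- **Strict transform, chart `D₊(x₀)`, `b = y₂`**: `f₀ ↦ y₂^{d+1} · (y₀·B(y₁,1) + y₂·C(y₁,1) + A(y₁,1))`. [cite: Hu2025, §5 Prop. 5.3] -/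
theorem subst₂_f₀ : coordBlowupSubst K CuspCone.cenVars 2
    (aeval (![X 1, X 2] : Fin 2 → MvPolynomial (Fin 3) K) A + X 0 * aeval (![X 1, X 2] : Fin 2 → MvPolynomial (Fin 3) K) B +
      aeval (![X 1, X 2] : Fin 2 → MvPolynomial (Fin 3) K) C) =
    X 2 ^ (d + 1) * (X 0 * aeval (![X 1, 1] : Fin 2 → MvPolynomial (Fin 3) K) B +
      X 2 * aeval (![X 1, 1] : Fin 2 → MvPolynomial (Fin 3) K) C + aeval (![X 1, 1] : Fin 2 → MvPolynomial (Fin 3) K) A) := by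
  obtain ⟨h0, -, -⟩ := CuspCone.subst₂_X K
  rw [map_add, map_add, map_mul, h0, subst_aeval K 2 _ _ _ (subst₂_g K) A hA, subst_aeval K 2 _ _ _ (subst₂_g K) B hB,
    subst_aeval K 2 _ _ _ (subst₂_g K) C hC]
  ring

include hA hB hC in
/-- **Strict transform, chart `D₊(x₁)`, `b = y₁`**: `f₁ ↦ y₁^{d+1} · (y₀·A(1,y₂) + y₁·C(1,y₂) + B(1,y₂))`. [cite: Hu2025, §5 Prop. 5.3] -/
theorem subst₁_f₁ : coordBlowupSubst K CuspCone.cenVars 1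
    (X 0 * aeval (![X 1, X 2] : Fin 2 → MvPolynomial (Fin 3) K) A + aeval (![X 1, X 2] : Fin 2 → MvPolynomial (Fin 3) K) B +
      aeval (![X 1, X 2] : Fin 2 → MvPolynomial (Fin 3) K) C) =
    X 1 ^ (d + 1) * (X 0 * aeval (![1, X 2] : Fin 2 → MvPolynomial (Fin 3) K) A +
      X 1 * aeval (![1, X 2] : Fin 2 → MvPolynomial (Fin 3) K) C + aeval (![1, X 2] : Fin 2 → MvPolynomial (Fin 3) K) B) := by
  obtain ⟨h0, -, -⟩ := CuspCone.subst₁_X K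
  rw [map_add, map_add, map_mul, h0, subst_aeval K 1 _ _ _ (subst₁_g K) A hA, subst_aeval K 1 _ _ _ (subst₁_g K) B hB,
    subst_aeval K 1 _ _ _ (subst₁_g K) C hC]
  ring

include hA hB hC in
/-- **Strict transform, chart `D₊(x₁)`, `b = y₂`**: `f₁ ↦ y₂^{d+1} · (y₀·A(y₁,1) + y₂·C(y₁,1) + B(y₁,1))`. [cite: Hu2025, §5 Prop. 5.3] -/
theorem subst₂_f₁ : coordBlowupSubst K CuspCone.cenVars 2
    (X 0 * aeval (![X 1, X 2] : Fin 2 → MvPolynomial (Fin 3) K) A + aeval (![X 1, X 2] : Fin 2 → MvPolynomial (Fin 3) K) B +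
      aeval (![X 1, X 2] : Fin 2 → MvPolynomial (Fin 3) K) C) =
    X 2 ^ (d + 1) * (X 0 * aeval (![X 1, 1] : Fin 2 → MvPolynomial (Fin 3) K) A +
      X 2 * aeval (![X 1, 1] : Fin 2 → MvPolynomial (Fin 3) K) C + aeval (![X 1, 1] : Fin 2 → MvPolynomial (Fin 3) K) B) := by
  obtain ⟨h0, -, -⟩ := CuspCone.subst₂_X K
  rw [map_add, map_add, map_mul, h0, subst_aeval K 2 _ _ _ (subst₂_g K) A hA, subst_aeval K 2 _ _ _ (subst₂_g K) B hB,
    subst_aeval K 2 _ _ _ (subst₂_g K) C hC]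
  ring

end Family

/-- **All four dehomogenisations of a prime form span radical ideals** (each is irreducible or a unit: tree
`irreducible_or_isUnit_dehomogenize`). [cite: Hartshorne1977, I §2, Ex. 2.10] -/
theorem radical_span_dehomogenize (F : MvPolynomial (Fin 4) K) {e : ℕ} (hFh : F.IsHomogeneous e) (hFp : Prime F) (c : Fin (2 + 2)) :
    (Ideal.span {dehomogenize K c F}).radical = Ideal.span {dehomogenize K c F} := by
  rcases irreducible_or_isUnit_dehomogenize (i := c) hFh hFp.irreducible with hirr | hu
  · exact ((Ideal.span_singleton_prime hirr.ne_zero).mpr (UniqueFactorizationMonoid.irreducible_iff_prime.mp hirr)).radical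
  · rw [Ideal.span_singleton_eq_top.mpr hu, Ideal.radical_top]

/-! ## Regularity of the six chart rings and the certificates -/

section Certificates

variable [IsAlgClosed K] {d : ℕ} (A B C : MvPolynomial (Fin 2) K) (hA : A.IsHomogeneous (d + 1)) (hB : B.IsHomogeneous (d + 1))
  (hC : C.IsHomogeneous (d + 2)) (F : MvPolynomial (Fin 4) K)
  (hF : F = X 0 * rename (![2, 3] : Fin 2 → Fin 4) A + X 1 * rename (![2, 3] : Fin 2 → Fin 4) B + rename (![2, 3] : Fin 2 → Fin 4) C)
  (hprime : Prime F) (hAB : A ≠ 0 ∨ B ≠ 0)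
  (hnc : ∀ v : Fin 2 → K, v ≠ 0 → ¬ (MvPolynomial.eval v A = 0 ∧ MvPolynomial.eval v B = 0 ∧ MvPolynomial.eval v C = 0))

include hnc in
/-- **The chart ring equation off the line, `D₊(x₂)`**: `K[y]/(y₀·A(1,y₂) + y₁·B(1,y₂) + C(1,y₂))` is regular. [cite: StacksProject, Tag 07PF] -/
theorem isRegularRing_quotient_f₂ :
    IsRegularRing (MvPolynomial (Fin 3) K ⧸ Ideal.span {X 0 * aeval (![1, X 2] : Fin 2 → MvPolynomial (Fin 3) K) A +
      X 1 * aeval (![1, X 2] : Fin 2 → MvPolynomial (Fin 3) K) B + aeval (![1, X 2] : Fin 2 → MvPolynomial (Fin 3) K) C}) :=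
  isRegularRing_quotient_lin K _ _ _ 0 1 (by decide)
    (pderiv_aeval_dehomog₁ K 0 (by decide) A) (pderiv_aeval_dehomog₁ K 0 (by decide) B) (pderiv_aeval_dehomog₁ K 0 (by decide) C)
    (pderiv_aeval_dehomog₁ K 1 (by decide) A) (pderiv_aeval_dehomog₁ K 1 (by decide) B) (pderiv_aeval_dehomog₁ K 1 (by decide) C)
    (no_common_zero_aeval K A B C hnc _ 0 rfl)

include hnc in
/-- **The chart ring equation off the line, `D₊(x₃)`**: `K[y]/(y₀·A(y₂,1) + y₁·B(y₂,1) + C(y₂,1))` is regular. [cite: StacksProject, Tag 07PF] -/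
theorem isRegularRing_quotient_f₃ :
    IsRegularRing (MvPolynomial (Fin 3) K ⧸ Ideal.span {X 0 * aeval (![X 2, 1] : Fin 2 → MvPolynomial (Fin 3) K) A +
      X 1 * aeval (![X 2, 1] : Fin 2 → MvPolynomial (Fin 3) K) B + aeval (![X 2, 1] : Fin 2 → MvPolynomial (Fin 3) K) C}) :=
  isRegularRing_quotient_lin K _ _ _ 0 1 (by decide)
    (pderiv_aeval_dehomog₃ K 0 (by decide) A) (pderiv_aeval_dehomog₃ K 0 (by decide) B) (pderiv_aeval_dehomog₃ K 0 (by decide) C)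
    (pderiv_aeval_dehomog₃ K 1 (by decide) A) (pderiv_aeval_dehomog₃ K 1 (by decide) B) (pderiv_aeval_dehomog₃ K 1 (by decide) C)
    (no_common_zero_aeval K A B C hnc _ 1 rfl)

include hnc in
/-- **The strict-transform equations on the `y₁`-charts are regular**: `K[y]/(y₀·P(1,y₂) + y₁·C(1,y₂) + Q(1,y₂))` for `{P, Q} = {A, B}`.
[cite: StacksProject, Tag 07PF] -/
theorem isRegularRing_quotient_strict₁ (P Q : MvPolynomial (Fin 2) K) (hPQ : (P = A ∧ Q = B) ∨ (P = B ∧ Q = A)) :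
    IsRegularRing (MvPolynomial (Fin 3) K ⧸ Ideal.span {X 0 * aeval (![1, X 2] : Fin 2 → MvPolynomial (Fin 3) K) P +
      X 1 * aeval (![1, X 2] : Fin 2 → MvPolynomial (Fin 3) K) C + aeval (![1, X 2] : Fin 2 → MvPolynomial (Fin 3) K) Q}) := by
  refine isRegularRing_quotient_lin K _ _ _ 0 1 (by decide)
    (pderiv_aeval_dehomog₁ K 0 (by decide) P) (pderiv_aeval_dehomog₁ K 0 (by decide) C) (pderiv_aeval_dehomog₁ K 0 (by decide) Q)
    (pderiv_aeval_dehomog₁ K 1 (by decide) P) (pderiv_aeval_dehomog₁ K 1 (by decide) C) (pderiv_aeval_dehomog₁ K 1 (by decide) Q)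
    fun x hx => ?_
  have h := no_common_zero_aeval K A B C hnc (![1, X 2] : Fin 2 → MvPolynomial (Fin 3) K) 0 rfl x
  rcases hPQ with ⟨rfl, rfl⟩ | ⟨rfl, rfl⟩
  · exact h ⟨hx.1, hx.2.2, hx.2.1⟩
  · exact h ⟨hx.2.2, hx.1, hx.2.1⟩

include hnc in
/-- **The strict-transform equations on the `y₂`-charts are regular**: `K[y]/(y₀·P(y₁,1) + y₂·C(y₁,1) + Q(y₁,1))` for `{P, Q} = {A, B}`.
[cite: StacksProject, Tag 07PF] -/
theorem isRegularRing_quotient_strict₂ (P Q : MvPolynomial (Fin 2) K) (hPQ : (P = A ∧ Q = B) ∨ (P = B ∧ Q = A)) :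
    IsRegularRing (MvPolynomial (Fin 3) K ⧸ Ideal.span {X 0 * aeval (![X 1, 1] : Fin 2 → MvPolynomial (Fin 3) K) P +
      X 2 * aeval (![X 1, 1] : Fin 2 → MvPolynomial (Fin 3) K) C + aeval (![X 1, 1] : Fin 2 → MvPolynomial (Fin 3) K) Q}) := by
  refine isRegularRing_quotient_lin K _ _ _ 0 2 (by decide)
    (pderiv_aeval_dehomog₂ K 0 (by decide) P) (pderiv_aeval_dehomog₂ K 0 (by decide) C) (pderiv_aeval_dehomog₂ K 0 (by decide) Q)
    (pderiv_aeval_dehomog₂ K 2 (by decide) P) (pderiv_aeval_dehomog₂ K 2 (by decide) C) (pderiv_aeval_dehomog₂ K 2 (by decide) Q)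
    fun x hx => ?_
  have h := no_common_zero_aeval K A B C hnc (![X 1, 1] : Fin 2 → MvPolynomial (Fin 3) K) 1 rfl x
  rcases hPQ with ⟨rfl, rfl⟩ | ⟨rfl, rfl⟩
  · exact h ⟨hx.1, hx.2.2, hx.2.1⟩
  · exact h ⟨hx.2.2, hx.1, hx.2.1⟩

include hA hB hC hF hprime hnc in
/-- **The chart rings off the line are regular**: `ChartRing F 2 ≅ K[y]/(f₂)`, `ChartRing F 3 ≅ K[y]/(f₃)`
(`HypersurfaceSpecimen.exists_chartQuotEquiv`). [folklore] -/
theorem isRegularRing_chartRing_of_two_le (c : Fin 4) (hc : 2 ≤ (c : ℕ)) :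
    IsRegularRing (ChartRing F c (isHomogeneous_F K A B C hA hB hC F hF)) := by
  have hFh := isHomogeneous_F K A B C hA hB hC F hF
  have hc' : c = 2 ∨ c = 3 := by fin_cases c <;> simp at hc ⊢
  rcases hc' with rfl | rfl
  · have hrad := radical_span_dehomogenize K F hFh hprime 2
    rw [dehomogenize_eq₂ K A B C F hF] at hrad
    obtain ⟨θ, -⟩ := HypersurfaceSpecimen.exists_chartQuotEquiv F hFh 2 _ (dehomogenize_eq₂ K A B C F hF) hrad
    haveI := isRegularRing_quotient_f₂ K A B C hnc
    exact IsRegularRing.of_ringEquiv θ.symm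
  · have hrad := radical_span_dehomogenize K F hFh hprime 3
    rw [dehomogenize_eq₃ K A B C F hF] at hrad
    obtain ⟨θ, -⟩ := HypersurfaceSpecimen.exists_chartQuotEquiv F hFh 3 _ (dehomogenize_eq₃ K A B C F hF) hrad
    haveI := isRegularRing_quotient_f₃ K A B C hnc
    exact IsRegularRing.of_ringEquiv θ.symm

include hA hB hC hF hprime hAB hnc in
/-- ★ **EVERY BLOW-UP OF `H = V₊(F)` ALONG `𝓘⟨Σ⟩ · 𝒪_H` IS REGULAR** for the whole family `F = x₀·A + x₁·B + C(x₂,x₃)` — ONE application of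
`DoubleLine.isRegular_of_isBlowup_comap_vanishingIdeal` (p645742) with the four strict-transform charts certified by
`CuspCone.isRegularRing_strictTransformChart` (p643466). [OURS · lh7] [cite: StacksProject, Tag 0804] -/
theorem isRegular_blowups :
    ∀ (Z : Scheme.{0}) (ρ : Z ⟶ (hypersurface F).left),
      IsBlowup ρ ((vanishingIdeal (⟨_, WhitneyCubic.isClosed_doubleLine K⟩ :
        Closeds (Literature.AlgebraicGeometry.Motives.projectiveSpace 3 K).left)).comap (hypersurfaceι F).left) →
      Scheme.IsRegular Z := by
  have hFh := isHomogeneous_F K A B C hA hB hC F hF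
  have hrad₀ := radical_span_dehomogenize K F hFh hprime 0
  rw [dehomogenize_eq₀ K A B C F hF] at hrad₀
  have hrad₁ := radical_span_dehomogenize K F hFh hprime 1
  rw [dehomogenize_eq₁ K A B C F hF] at hrad₁
  exact DoubleLine.isRegular_of_isBlowup_comap_vanishingIdeal K F hFh (by omega)
    (isRegularRing_chartRing_of_two_le K A B C hA hB hC F hF hprime hnc) _ _
    (dehomogenize_eq₀ K A B C F hF) (dehomogenize_eq₁ K A B C F hF) hrad₀ hrad₁
    (CuspCone.isRegularRing_strictTransformChart K _ _ 1 (d + 1) (subst₁_f₀ K A B C hA hB hC)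
      (not_X_one_dvd K B A hB hA hAB.symm _) (isRegularRing_quotient_strict₁ K A B C hnc B A (Or.inr ⟨rfl, rfl⟩)))
    (CuspCone.isRegularRing_strictTransformChart K _ _ 2 (d + 1) (subst₂_f₀ K A B C hA hB hC)
      (not_X_two_dvd K B A hB hA hAB.symm _) (isRegularRing_quotient_strict₂ K A B C hnc B A (Or.inr ⟨rfl, rfl⟩)))
    (CuspCone.isRegularRing_strictTransformChart K _ _ 1 (d + 1) (subst₁_f₁ K A B C hA hB hC)
      (not_X_one_dvd K A B hA hB hAB _) (isRegularRing_quotient_strict₁ K A B C hnc A B (Or.inl ⟨rfl, rfl⟩)))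
    (CuspCone.isRegularRing_strictTransformChart K _ _ 2 (d + 1) (subst₂_f₁ K A B C hA hB hC)
      (not_X_two_dvd K A B hA hB hAB _) (isRegularRing_quotient_strict₂ K A B C hnc A B (Or.inl ⟨rfl, rfl⟩)))

include hA hB hC hF hprime hAB hnc in
/-- ★ **REGULAR BLOW-UP MODEL, ALL `p`** — the currency of crux `EquisingularLift`'s open residual (`stub_blowupModel_ge_five`, stmt-…-15660) at
these surfaces: `H = V₊(x₀·A + x₁·B + C(x₂,x₃))` carries a NON-ZERO ideal sheaf — `𝓘⟨Σ⟩ · 𝒪_H`, the trace of the line — ALL of whose blow-ups are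
regular (non-zero since `ι(H) ⊄ Σ`, `DoubleLine.not_range_subset_of_notMem`). [OURS · lh7] [cite: StacksProject, Tag 0804] -/
theorem blowupModel_submaxLine :
    ∃ 𝔞 : (hypersurface F).left.IdealSheafData, 𝔞 ≠ ⊥ ∧
      ∀ (Z : Scheme.{0}) (π : Z ⟶ (hypersurface F).left), IsBlowup π 𝔞 → Scheme.IsRegular Z := by
  refine ⟨(vanishingIdeal (⟨_, WhitneyCubic.isClosed_doubleLine K⟩ :
      Closeds (Literature.AlgebraicGeometry.Motives.projectiveSpace 3 K).left)).comap (hypersurfaceι F).left, ?_,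
    isRegular_blowups K A B C hA hB hC F hF hprime hAB hnc⟩
  intro h0
  apply DoubleLine.not_range_subset_of_notMem K F (isHomogeneous_F K A B C hA hB hC F hF) hprime
    (X_two_not_mem_span K A B C hA hB hC F hF hprime.ne_zero)
  rintro _ ⟨x, rfl⟩
  have hx : x ∈ (((vanishingIdeal (⟨_, WhitneyCubic.isClosed_doubleLine K⟩ :
      Closeds (Literature.AlgebraicGeometry.Motives.projectiveSpace 3 K).left)).comap (hypersurfaceι F).left).support :
        Set (hypersurface F).left) := by
    rw [h0, Scheme.IdealSheafData.support_bot]; trivial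
  rw [Scheme.IdealSheafData.support_comap] at hx
  have hx' : (hypersurfaceι F).left x ∈ (((vanishingIdeal (⟨_, WhitneyCubic.isClosed_doubleLine K⟩ :
      Closeds (Literature.AlgebraicGeometry.Motives.projectiveSpace 3 K).left)).support :
        Set (Literature.AlgebraicGeometry.Motives.projectiveSpace 3 K).left)) := hx
  rw [Scheme.IdealSheafData.coe_support_vanishingIdeal] at hx'
  exact hx'

include hA hB hC hF hprime hAB hnc in
/-- ★ **THE B‴ NOSE PREDICATE FOR THE WHOLE FAMILY**: `ReachNoseTowerBTriplePrime K 3 H ι` for `H = V₊(x₀·A + x₁·B + C(x₂,x₃))`, `K`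
algebraically closed (any characteristic), by `DoubleLine.reachNoseTowerBTriplePrime_of_isRegular_blowups` (p645692). [OURS · lh7] -/
theorem reachNoseTowerBTriplePrime_submaxLine :
    ReachNoseTowerBTriplePrime K 3 (hypersurface F).left (hypersurfaceι F).left :=
  DoubleLine.reachNoseTowerBTriplePrime_of_isRegular_blowups K F (isHomogeneous_F K A B C hA hB hC F hF) hprime
    (F_mem_span K A B C hA hB hC F hF) (X_two_not_mem_span K A B C hA hB hC F hF hprime.ne_zero)
    (isRegular_blowups K A B C hA hB hC F hF hprime hAB hnc)

include hA hB hC hF hprime hAB hnc in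
/-- ★★ **EL♮ FOR EVERY SURFACE OF DEGREE `d + 2` IN `ℙ³` WITH THE LINE `V(x₂, x₃)` OF MULTIPLICITY `d + 1`** — `ELNatAt p K 3 H ι` for
`H = V₊(x₀·A(x₂,x₃) + x₁·B(x₂,x₃) + C(x₂,x₃))`, `A, B` forms of degree `d + 1` not both zero, `C` a form of degree `d + 2`, `F` prime, `A, B, C`
without common zero on `ℙ¹`; `K` algebraically closed of characteristic `p`, ANY `p`.  Witness: `O = 𝕎(K)`, ONE blow-up of `ℙ³_O` along the
`O`-line `V(x₂, x₃)` (through `DoubleLine.elNatAt_of_isRegular_blowups`, p645692).  Instances: all four classical integral cubic surfaces with a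
double line and every cone over a singular integral plane cubic (`d = 1`), integral quartics with a triple line (`d = 2`), … — no case analysis.
[OURS · lh7] [cite: Hartshorne1977, I Ex. 5.12] -/
theorem elNatAt_submaxLine (p : ℕ) (hp : p.Prime) [CharP K p] :
    Theorems.EquisingularLift.ELNatAt p K 3 (hypersurface F).left (hypersurfaceι F).left :=
  DoubleLine.elNatAt_of_isRegular_blowups K p hp F (isHomogeneous_F K A B C hA hB hC F hF) (by omega) hprime
    (F_mem_span K A B C hA hB hC F hF) (X_two_not_mem_span K A B C hA hB hC F hF hprime.ne_zero)
    (radical_span_dehomogenize K F (isHomogeneous_F K A B C hA hB hC F hF) hprime)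
    (isRegular_blowups K A B C hA hB hC F hF hprime hAB hnc)

end Certificates

end SubmaxLine

end Summit.ResolutionOfSingularities.ResolutionOfSingularities.Cruxes.EquisingularLiftNat.Sections

end
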